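import Summits.BirchSwinnertonDyer.BirchSwinnertonDyer.Theorems.SylvesterTwoHeegnerIndexCoupledDescentFirstLayerOfNondivL1
import HarnessLib

/-!
# `stub_firstLayerFour` / `stub_firstLayerSeven` (VARIANT K) from leaf (L1) ON THE FIRST LAYER'S OWN
# SLICE — the NON-VACUOUS reductions (replacing p647879 / p648983, whose hypothesis is refutable)

Crux `UpperOffV0HSYPlus` (stmt-BirchSwinnertonDyer-19804), skeleton of record VARIANT K
(`Cruxes/UpperOffV0HSYPlus/Lines/coupled_variantK.lean` 9a39a679fe96c65a; D440).  p647879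
`firstLayerFour_of_L1 (hL1)` / p648983 `firstLayerSeven_of_thmC_of_L1 (hC) (hL1)` reduce the two
first-layer stubs to «leaf (L1) for EVERY non-2-divisible bottom point at EVERY member» — a hypothesis
that is REFUTABLE (sibling files `…FirstLayerOfNondivL1` §3, `…L1FamilyVacuity`): on paper (L1)[δY₀]
for an arbitrary non-divisible `Y₀` is only available on THEOREM K2's slice `m(p) = 0` (the CM bottom
point itself not `2`-divisible), i.e. exactly under the first layer's own antecedent
`ord₂(#Ш_an(B)·#Ш_an(A)) = 0`.

`firstLayerFour_of_layerL1 (hL1 : L1Four′) : <stub_firstLayerFour VERBATIM>` and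
`firstLayerSeven_of_layerL1 (hL1 : L1Seven′) : <stub_firstLayerSeven VERBATIM>`, where
**L1Four′ := `PublishedFactsTwoPlus →` stub_firstLayerFour's OWN binders (`p` prime, `p % 9 = 4`,
`3 ∉ 𝔽_p^{×3}`, minimal models `A ≅ E_{3p²}`, `B ≅ E_p`, `qB qA`, `shaAn B = qB`, `shaAn A = qA`,
`qB·qA ≠ 0`, `padicValRat 2 (qB·qA) = 0`) `→ ∀ K ω` (`ω² + ω + 1 = 0`, `finrank ℚ K = 2`)
`→ ∀ Y₀ ∉ 2E_p(K) →` (L1)[δY₀]** (p620148's binder at the conductor levels, Kol = the (L3) files' eight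
clauses) — leaf (L1) asked ONLY where it is THEOREM K2's (resp. COROLLARY K2(7)'s) genuine input.
Proof: `rank_ℤ B(ℚ(ζ₃)) = 2` from the route's display, ANY non-`2`-divisible `Y₀`
(`exists_not_two_nsmul_eq_cubeSumCurve`), then the display-free first layer
`natCard_primaryComponent_sha_eq_one_pair_of_nondiv_of_L1`.  THEOREM C (crux 19802) is NOT needed by the
`7 (9)` reduction any more (p648983 used it only to manufacture a non-divisible point); it stays a paper
input of the rows' proof of L1Seven′ (the halved system) and of K3R-7's composition.  Degenerate-member
pass: at a member with `Ш(E_p)[2] ≠ 0` the antecedent `padicValRat 2 (qB·qA) = 0` is false for the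
displayed `#Ш_an` (`= 16` at the certified rows), so L1Four′/L1Seven′ are NOT refuted by
`…L1FamilyVacuity`'s witnesses — the binder is vacuous exactly where (L1) fails.
Theorem-only; the stubs are NOT closed (L1Four′/L1Seven′ are research: rows k-p1); nothing asserted on
19804; no label moves; BSD not claimed for any curve.
-/

set_option linter.dupNamespace false -- Summits modules are `Summit.<Summit>.<Problem>…` by design

noncomputable section

open scoped Classical
open WeierstrassCurve WeierstrassCurve.Affine WeierstrassCurve.Affine.Point NumberField IsDedekindDomain
open Field Literature.NumberTheory.EllipticCurves Literature.NumberTheory.GaloisRepresentations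
open Literature.NumberTheory.EllipticCurves.HuShuYin2019
open Summit.BirchSwinnertonDyer.BirchSwinnertonDyer.Theses.SylvesterTwoHeegnerIndex
  hiding HSYPointTwoDivisibleSevenModNine

namespace Summit.BirchSwinnertonDyer.BirchSwinnertonDyer.Theorems.SylvesterTwoCoupledDescentCebotarev

/-- **`stub_firstLayerFour` ⟸ L1Four′ = leaf (L1) for every non-`2`-divisible bottom point UNDER THE FIRST
LAYER'S OWN HYPOTHESES** (`p ≡ 4 (9)`; levels = the conductors of the short models; `K` any quadratic
field with `ω`).  The conclusion after `hL1` is the registered stub's statement VERBATIM; `hL1`'s binder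
prefix up to `padicValRat 2 (qB * qA) = 0 →` is the stub's own. -/
theorem firstLayerFour_of_layerL1
    (hL1 : PublishedFactsTwoPlus →
      ∀ (p : ℕ), p.Prime → p % 9 = 4 → (¬ ∃ x : ZMod p, x ^ 3 = 3) →
        ∀ (A B : WeierstrassCurve ℚ) [A.IsElliptic] [A.IsGloballyMinimal] [B.IsElliptic]
          [B.IsGloballyMinimal], (∃ C : VariableChange ℚ, C • B = HuShuYin2019.cubeSumCurve (p : ℚ)) →
          (∃ C : VariableChange ℚ, C • A = HuShuYin2019.cubeSumCurve (3 * (p : ℚ) ^ 2)) →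
          ∀ (qB qA : ℚ), shaAn B = (qB : ℂ) → shaAn A = (qA : ℂ) → qB * qA ≠ 0 →
            padicValRat 2 (qB * qA) = 0 →
            ∀ (K : Type) [Field K] [NumberField K] (ω : K), ω ^ 2 + ω + 1 = 0 →
              Module.finrank ℚ K = 2 →
            ∀ Y₀ : ((cubeSumCurve (p : ℚ)).baseChange K).toAffine.Point,
              (¬ ∃ Q : ((cubeSumCurve (p : ℚ)).baseChange K).toAffine.Point, (2 : ℕ) • Q = Y₀) →
            ∃ (cA : ℕ → galH1Torsion ((cubeSumCurve (3 * (p : ℚ) ^ 2)).baseChange K) (2 : ℕ))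
              (cB : ℕ → galH1Torsion ((cubeSumCurve (p : ℚ)).baseChange K) (2 : ℕ)),
            (∀ ℓ, (ℓ.Prime ∧ ¬ ℓ ∣ (cubeSumCurve (3 * (p : ℚ) ^ 2)).conductorNorm ℤ ∧
                ¬ ℓ ∣ (cubeSumCurve (p : ℚ)).conductorNorm ℤ ∧ ¬ ((ℓ : ℤ) ∣ NumberField.discr K) ∧ ℓ ≠ 2 ∧
                (Ideal.span {(ℓ : 𝓞 K)}).IsPrime ∧
                FrobEqFrobInfty (cubeSumCurve (3 * (p : ℚ) ^ 2)) K 2 ℓ ∧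
                FrobEqFrobInfty (cubeSumCurve (p : ℚ)) K 2 ℓ) →
              (∀ v : HeightOneSpectrum (𝓞 K), (ℓ : 𝓞 K) ∉ v.asIdeal →
                cA ℓ ∈ selmerLocalKer ((cubeSumCurve (3 * (p : ℚ) ^ 2)).baseChange K)
                  (v.adicCompletion K) (2 : ℕ)) ∧
              (∀ x : InfinitePlace K, cA ℓ ∈ selmerLocalKer
                ((cubeSumCurve (3 * (p : ℚ) ^ 2)).baseChange K) x.Completion (2 : ℕ)) ∧
              (∀ v : HeightOneSpectrum (𝓞 K), (ℓ : 𝓞 K) ∈ v.asIdeal →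
                (cA ℓ ∈ selmerLocalKer ((cubeSumCurve (3 * (p : ℚ) ^ 2)).baseChange K)
                    (v.adicCompletion K) (2 : ℕ) ↔
                  kummerClassOfPoint (cubeSumCurve (p : ℚ)) K Nat.prime_two Y₀ ∈
                    ((cubeSumCurve (p : ℚ)).baseChange K).torsionLocalKer (v.adicCompletion K) (2 : ℕ)))) ∧
            (∀ ℓ ℓ', (ℓ.Prime ∧ ¬ ℓ ∣ (cubeSumCurve (3 * (p : ℚ) ^ 2)).conductorNorm ℤ ∧
                ¬ ℓ ∣ (cubeSumCurve (p : ℚ)).conductorNorm ℤ ∧ ¬ ((ℓ : ℤ) ∣ NumberField.discr K) ∧ ℓ ≠ 2 ∧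
                (Ideal.span {(ℓ : 𝓞 K)}).IsPrime ∧
                FrobEqFrobInfty (cubeSumCurve (3 * (p : ℚ) ^ 2)) K 2 ℓ ∧
                FrobEqFrobInfty (cubeSumCurve (p : ℚ)) K 2 ℓ) →
              (ℓ'.Prime ∧ ¬ ℓ' ∣ (cubeSumCurve (3 * (p : ℚ) ^ 2)).conductorNorm ℤ ∧
                ¬ ℓ' ∣ (cubeSumCurve (p : ℚ)).conductorNorm ℤ ∧ ¬ ((ℓ' : ℤ) ∣ NumberField.discr K) ∧
                ℓ' ≠ 2 ∧ (Ideal.span {(ℓ' : 𝓞 K)}).IsPrime ∧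
                FrobEqFrobInfty (cubeSumCurve (3 * (p : ℚ) ^ 2)) K 2 ℓ' ∧
                FrobEqFrobInfty (cubeSumCurve (p : ℚ)) K 2 ℓ') → ℓ ≠ ℓ' →
              (∀ v : HeightOneSpectrum (𝓞 K), (ℓ : 𝓞 K) ∉ v.asIdeal → (ℓ' : 𝓞 K) ∉ v.asIdeal →
                cB (ℓ * ℓ') ∈ selmerLocalKer ((cubeSumCurve (p : ℚ)).baseChange K)
                  (v.adicCompletion K) (2 : ℕ)) ∧
              (∀ x : InfinitePlace K,
                cB (ℓ * ℓ') ∈ selmerLocalKer ((cubeSumCurve (p : ℚ)).baseChange K) x.Completion (2 : ℕ)) ∧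
              (∀ v : HeightOneSpectrum (𝓞 K), (ℓ : 𝓞 K) ∈ v.asIdeal →
                (cB (ℓ * ℓ') ∈ selmerLocalKer ((cubeSumCurve (p : ℚ)).baseChange K)
                    (v.adicCompletion K) (2 : ℕ) ↔
                  cA ℓ' ∈ ((cubeSumCurve (3 * (p : ℚ) ^ 2)).baseChange K).torsionLocalKer
                    (v.adicCompletion K) (2 : ℕ))))) :
    PublishedFactsTwoPlus →
    ∀ (p : ℕ), p.Prime → p % 9 = 4 → (¬ ∃ x : ZMod p, x ^ 3 = 3) →
      ∀ (A B : WeierstrassCurve ℚ) [A.IsElliptic] [A.IsGloballyMinimal] [B.IsElliptic]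
        [B.IsGloballyMinimal], (∃ C : VariableChange ℚ, C • B = HuShuYin2019.cubeSumCurve (p : ℚ)) →
        (∃ C : VariableChange ℚ, C • A = HuShuYin2019.cubeSumCurve (3 * (p : ℚ) ^ 2)) →
        ∀ (qB qA : ℚ), shaAn B = (qB : ℂ) → shaAn A = (qA : ℂ) → qB * qA ≠ 0 →
          padicValRat 2 (qB * qA) = 0 →
          Nat.card (AddCommGroup.primaryComponent B.sha 2) = 1 ∧
            Nat.card (AddCommGroup.primaryComponent A.sha 2) = 1 := by
  intro hF p hp h9 h3 A B _ _ _ _ hB hA qB qA hqB hqA hne hv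
  have hL1' := hL1 hF p hp h9 h3 A B hB hA qB qA hqB hqA hne hv
  -- the CM field `K = ℚ(ζ₃)` with `ω = ζ₃`
  haveI : IsCyclotomicExtension {3} ℚ (CyclotomicField 3 ℚ) :=
    CyclotomicField.isCyclotomicExtension 3 ℚ
  obtain ⟨ω, hω⟩ : ∃ ω : CyclotomicField 3 ℚ, ω ^ 2 + ω + 1 = 0 :=
    ⟨_, SylvesterTwoCMNormForm.sq_add_self_add_one_eq_zero_of_isPrimitiveRoot
      (IsCyclotomicExtension.zeta_spec 3 ℚ (CyclotomicField 3 ℚ))⟩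
  have h2 : Module.finrank ℚ (CyclotomicField 3 ℚ) = 2 :=
    SylvesterTwoCMNormForm.finrank_cyclotomicField_three
  -- `rank_ℤ B(K) = 2` from the route's display (its only use here)
  obtain ⟨-, -, -, -, -, hrank, -⟩ := hF.2 p hp (Or.inl h9) h3 A B hB hA (CyclotomicField 3 ℚ) ω hω h2
  obtain ⟨CB, hCB⟩ := hB
  obtain ⟨CA, hCA⟩ := hA
  have hp3 : p % 3 = 1 := by omega
  have hp2 : p ≠ 2 := by rintro rfl; norm_num at h9
  have hp0 : (p : ℚ) ≠ 0 := by exact_mod_cast hp.ne_zero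
  have h3p0 : (3 * (p : ℚ) ^ 2) ≠ 0 := mul_ne_zero (by norm_num) (pow_ne_zero 2 hp0)
  haveI := Rank1Residual.X12.CubeSumFamilies.isElliptic_cubeSumCurve hp0
  haveI := Rank1Residual.X12.CubeSumFamilies.isElliptic_cubeSumCurve h3p0
  -- levels = conductors
  haveI : NeZero ((cubeSumCurve (p : ℚ)).conductorNorm ℤ) :=
    ⟨(conductorNorm_pos_holds (cubeSumCurve (p : ℚ))).ne'⟩
  haveI : NeZero ((cubeSumCurve (3 * (p : ℚ) ^ 2)).conductorNorm ℤ) :=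
    ⟨(conductorNorm_pos_holds (cubeSumCurve (3 * (p : ℚ) ^ 2))).ne'⟩
  -- ANY non-`2`-divisible bottom point of `E_p(K)` (rank `2`)
  have hrank₀ : ((cubeSumCurve (p : ℚ)).baseChange (CyclotomicField 3 ℚ)).mordellWeilRank = 2 :=
    mordellWeilRank_cubeSumCurve_of_variableChange B CB hCB hrank
  obtain ⟨Y₀, hY₀⟩ := exists_not_two_nsmul_eq_cubeSumCurve hω h2 hp hp2 hrank₀
  exact natCard_primaryComponent_sha_eq_one_pair_of_nondiv_of_L1 h2 hω hp hp3 A B CA CB hCA hCB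
    hrank dvd_rfl dvd_rfl Y₀ hY₀ (hL1' (CyclotomicField 3 ℚ) ω hω h2 Y₀ hY₀)

/-- **`stub_firstLayerSeven` ⟸ L1Seven′ = leaf (L1) for every non-`2`-divisible bottom point UNDER THE FIRST
LAYER'S OWN HYPOTHESES** (`p ≡ 7 (9)`; levels = the conductors of the short models; `K` any quadratic
field with `ω`).  The conclusion after `hL1` is the registered stub's statement VERBATIM; `hL1`'s binder
prefix up to `padicValRat 2 (qB * qA) = 0 →` is the stub's own. -/
theorem firstLayerSeven_of_layerL1
    (hL1 : PublishedFactsTwoPlus →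
      ∀ (p : ℕ), p.Prime → p % 9 = 7 → (¬ ∃ x : ZMod p, x ^ 3 = 3) →
        ∀ (A B : WeierstrassCurve ℚ) [A.IsElliptic] [A.IsGloballyMinimal] [B.IsElliptic]
          [B.IsGloballyMinimal], (∃ C : VariableChange ℚ, C • B = HuShuYin2019.cubeSumCurve (p : ℚ)) →
          (∃ C : VariableChange ℚ, C • A = HuShuYin2019.cubeSumCurve (3 * (p : ℚ) ^ 2)) →
          ∀ (qB qA : ℚ), shaAn B = (qB : ℂ) → shaAn A = (qA : ℂ) → qB * qA ≠ 0 →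
            padicValRat 2 (qB * qA) = 0 →
            ∀ (K : Type) [Field K] [NumberField K] (ω : K), ω ^ 2 + ω + 1 = 0 →
              Module.finrank ℚ K = 2 →
            ∀ Y₀ : ((cubeSumCurve (p : ℚ)).baseChange K).toAffine.Point,
              (¬ ∃ Q : ((cubeSumCurve (p : ℚ)).baseChange K).toAffine.Point, (2 : ℕ) • Q = Y₀) →
            ∃ (cA : ℕ → galH1Torsion ((cubeSumCurve (3 * (p : ℚ) ^ 2)).baseChange K) (2 : ℕ))
              (cB : ℕ → galH1Torsion ((cubeSumCurve (p : ℚ)).baseChange K) (2 : ℕ)),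
            (∀ ℓ, (ℓ.Prime ∧ ¬ ℓ ∣ (cubeSumCurve (3 * (p : ℚ) ^ 2)).conductorNorm ℤ ∧
                ¬ ℓ ∣ (cubeSumCurve (p : ℚ)).conductorNorm ℤ ∧ ¬ ((ℓ : ℤ) ∣ NumberField.discr K) ∧ ℓ ≠ 2 ∧
                (Ideal.span {(ℓ : 𝓞 K)}).IsPrime ∧
                FrobEqFrobInfty (cubeSumCurve (3 * (p : ℚ) ^ 2)) K 2 ℓ ∧
                FrobEqFrobInfty (cubeSumCurve (p : ℚ)) K 2 ℓ) →
              (∀ v : HeightOneSpectrum (𝓞 K), (ℓ : 𝓞 K) ∉ v.asIdeal →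
                cA ℓ ∈ selmerLocalKer ((cubeSumCurve (3 * (p : ℚ) ^ 2)).baseChange K)
                  (v.adicCompletion K) (2 : ℕ)) ∧
              (∀ x : InfinitePlace K, cA ℓ ∈ selmerLocalKer
                ((cubeSumCurve (3 * (p : ℚ) ^ 2)).baseChange K) x.Completion (2 : ℕ)) ∧
              (∀ v : HeightOneSpectrum (𝓞 K), (ℓ : 𝓞 K) ∈ v.asIdeal →
                (cA ℓ ∈ selmerLocalKer ((cubeSumCurve (3 * (p : ℚ) ^ 2)).baseChange K)
                    (v.adicCompletion K) (2 : ℕ) ↔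
                  kummerClassOfPoint (cubeSumCurve (p : ℚ)) K Nat.prime_two Y₀ ∈
                    ((cubeSumCurve (p : ℚ)).baseChange K).torsionLocalKer (v.adicCompletion K) (2 : ℕ)))) ∧
            (∀ ℓ ℓ', (ℓ.Prime ∧ ¬ ℓ ∣ (cubeSumCurve (3 * (p : ℚ) ^ 2)).conductorNorm ℤ ∧
                ¬ ℓ ∣ (cubeSumCurve (p : ℚ)).conductorNorm ℤ ∧ ¬ ((ℓ : ℤ) ∣ NumberField.discr K) ∧ ℓ ≠ 2 ∧
                (Ideal.span {(ℓ : 𝓞 K)}).IsPrime ∧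
                FrobEqFrobInfty (cubeSumCurve (3 * (p : ℚ) ^ 2)) K 2 ℓ ∧
                FrobEqFrobInfty (cubeSumCurve (p : ℚ)) K 2 ℓ) →
              (ℓ'.Prime ∧ ¬ ℓ' ∣ (cubeSumCurve (3 * (p : ℚ) ^ 2)).conductorNorm ℤ ∧
                ¬ ℓ' ∣ (cubeSumCurve (p : ℚ)).conductorNorm ℤ ∧ ¬ ((ℓ' : ℤ) ∣ NumberField.discr K) ∧
                ℓ' ≠ 2 ∧ (Ideal.span {(ℓ' : 𝓞 K)}).IsPrime ∧
                FrobEqFrobInfty (cubeSumCurve (3 * (p : ℚ) ^ 2)) K 2 ℓ' ∧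
                FrobEqFrobInfty (cubeSumCurve (p : ℚ)) K 2 ℓ') → ℓ ≠ ℓ' →
              (∀ v : HeightOneSpectrum (𝓞 K), (ℓ : 𝓞 K) ∉ v.asIdeal → (ℓ' : 𝓞 K) ∉ v.asIdeal →
                cB (ℓ * ℓ') ∈ selmerLocalKer ((cubeSumCurve (p : ℚ)).baseChange K)
                  (v.adicCompletion K) (2 : ℕ)) ∧
              (∀ x : InfinitePlace K,
                cB (ℓ * ℓ') ∈ selmerLocalKer ((cubeSumCurve (p : ℚ)).baseChange K) x.Completion (2 : ℕ)) ∧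
              (∀ v : HeightOneSpectrum (𝓞 K), (ℓ : 𝓞 K) ∈ v.asIdeal →
                (cB (ℓ * ℓ') ∈ selmerLocalKer ((cubeSumCurve (p : ℚ)).baseChange K)
                    (v.adicCompletion K) (2 : ℕ) ↔
                  cA ℓ' ∈ ((cubeSumCurve (3 * (p : ℚ) ^ 2)).baseChange K).torsionLocalKer
                    (v.adicCompletion K) (2 : ℕ))))) :
    PublishedFactsTwoPlus →
    ∀ (p : ℕ), p.Prime → p % 9 = 7 → (¬ ∃ x : ZMod p, x ^ 3 = 3) →
      ∀ (A B : WeierstrassCurve ℚ) [A.IsElliptic] [A.IsGloballyMinimal] [B.IsElliptic]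
        [B.IsGloballyMinimal], (∃ C : VariableChange ℚ, C • B = HuShuYin2019.cubeSumCurve (p : ℚ)) →
        (∃ C : VariableChange ℚ, C • A = HuShuYin2019.cubeSumCurve (3 * (p : ℚ) ^ 2)) →
        ∀ (qB qA : ℚ), shaAn B = (qB : ℂ) → shaAn A = (qA : ℂ) → qB * qA ≠ 0 →
          padicValRat 2 (qB * qA) = 0 →
          Nat.card (AddCommGroup.primaryComponent B.sha 2) = 1 ∧
            Nat.card (AddCommGroup.primaryComponent A.sha 2) = 1 := by
  intro hF p hp h9 h3 A B _ _ _ _ hB hA qB qA hqB hqA hne hv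
  have hL1' := hL1 hF p hp h9 h3 A B hB hA qB qA hqB hqA hne hv
  -- the CM field `K = ℚ(ζ₃)` with `ω = ζ₃`
  haveI : IsCyclotomicExtension {3} ℚ (CyclotomicField 3 ℚ) :=
    CyclotomicField.isCyclotomicExtension 3 ℚ
  obtain ⟨ω, hω⟩ : ∃ ω : CyclotomicField 3 ℚ, ω ^ 2 + ω + 1 = 0 :=
    ⟨_, SylvesterTwoCMNormForm.sq_add_self_add_one_eq_zero_of_isPrimitiveRoot
      (IsCyclotomicExtension.zeta_spec 3 ℚ (CyclotomicField 3 ℚ))⟩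
  have h2 : Module.finrank ℚ (CyclotomicField 3 ℚ) = 2 :=
    SylvesterTwoCMNormForm.finrank_cyclotomicField_three
  -- `rank_ℤ B(K) = 2` from the route's display (its only use here)
  obtain ⟨-, -, -, -, -, hrank, -⟩ := hF.2 p hp (Or.inr h9) h3 A B hB hA (CyclotomicField 3 ℚ) ω hω h2
  obtain ⟨CB, hCB⟩ := hB
  obtain ⟨CA, hCA⟩ := hA
  have hp3 : p % 3 = 1 := by omega
  have hp2 : p ≠ 2 := by rintro rfl; norm_num at h9
  have hp0 : (p : ℚ) ≠ 0 := by exact_mod_cast hp.ne_zero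
  have h3p0 : (3 * (p : ℚ) ^ 2) ≠ 0 := mul_ne_zero (by norm_num) (pow_ne_zero 2 hp0)
  haveI := Rank1Residual.X12.CubeSumFamilies.isElliptic_cubeSumCurve hp0
  haveI := Rank1Residual.X12.CubeSumFamilies.isElliptic_cubeSumCurve h3p0
  -- levels = conductors
  haveI : NeZero ((cubeSumCurve (p : ℚ)).conductorNorm ℤ) :=
    ⟨(conductorNorm_pos_holds (cubeSumCurve (p : ℚ))).ne'⟩
  haveI : NeZero ((cubeSumCurve (3 * (p : ℚ) ^ 2)).conductorNorm ℤ) :=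
    ⟨(conductorNorm_pos_holds (cubeSumCurve (3 * (p : ℚ) ^ 2))).ne'⟩
  -- ANY non-`2`-divisible bottom point of `E_p(K)` (rank `2`)
  have hrank₀ : ((cubeSumCurve (p : ℚ)).baseChange (CyclotomicField 3 ℚ)).mordellWeilRank = 2 :=
    mordellWeilRank_cubeSumCurve_of_variableChange B CB hCB hrank
  obtain ⟨Y₀, hY₀⟩ := exists_not_two_nsmul_eq_cubeSumCurve hω h2 hp hp2 hrank₀
  exact natCard_primaryComponent_sha_eq_one_pair_of_nondiv_of_L1 h2 hω hp hp3 A B CA CB hCA hCB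
    hrank dvd_rfl dvd_rfl Y₀ hY₀ (hL1' (CyclotomicField 3 ℚ) ω hω h2 Y₀ hY₀)

end Summit.BirchSwinnertonDyer.BirchSwinnertonDyer.Theorems.SylvesterTwoCoupledDescentCebotarev

end
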